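import Summits.QuantumFields.YangMills.Theorems.IR.SCFloorFacingPlaquetteRep
import Mathlib.Analysis.Complex.Liouville
import Mathlib.Analysis.Complex.RealDeriv

/-!
# Strong-coupling floor engine, part 21: the facing-plaquette correlator AND ITS β-DERIVATIVE to leading order, uniformly in the volume

Pooled prover `ym-ir-line-bsf-p1` (LEAD of line `beta-slope-floor`, crux `IR`, stmt-QuantumFields-19354).  Support
file for part 22 (`SCFloorSlopeLaw`: the volume-uniform `4/b` law for the β-slope, i.e. the line's strong-coupling
rung at `n = 1` with constants independent of the torus).  Content:

* `norm_deriv_le_of_norm_le_pow` — a Cauchy estimate: if `f` is holomorphic on `‖z‖ < R'` with the order-`n` Schwarz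
  bound `‖f z‖ ≤ M (‖z‖/r)^n` on the complex disc `‖z‖ ≤ r < R'`, then `‖f'(b)‖ ≤ (2M(3/2)^n/r^n)·b^(n−1)` at real
  `0 < b ≤ r/2` (Cauchy's inequality on the circle of radius `b/2` about `b`);
* `cov_facing_deriv_estimate` — there are `K₁, K₂ ≥ 0`, `b₀ > 0` depending only on `ρ` such that on EVERY torus
  `(ℤ/L)⁴`, `L ≥ 3`, for `0 < b ≤ b₀`: `|D_L(b) − J b⁴| ≤ K₁ b⁵` and `b ↦ D_L(b)` has a derivative `D'` at `b` with
  `|D' − 4J b³| ≤ K₂ b⁴`, where `D_L(b) = latticeConnectedCorr ρ b L P P 1` (`P = plaquetteObs ρ 0 1 2`) and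
  `J = φ^{*6}(1)`, `φ = Re tr ρ − ∫ Re tr ρ`.

Method (the engine's holomorphic picture, part 10 `cov_facing_schwarz`, whose set-up is re-run here): `D_L` is the
real trace of `C_L(z) = ⟨Φ₁Φ₂⟩_z − ⟨Φ₁⟩_z⟨Φ₂⟩_z`, holomorphic on the strong-coupling disc `‖z‖ < β_R` with a bound
UNIFORM in `L` (Osterwalder–Seiler machinery, `PlaqSystem.norm_truncatedExpect_le_const`); `G_L := C_L − J z⁴` has
analytic order `≥ 5` at `0` (part 9 on each torus + `isBigO_pow_of_real_bound`), so the Schwarz lemma with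
multiplicity (`norm_le_of_isBigO_pow`) bounds `‖G_L(z)‖ ≤ K_g(‖z‖/r)⁵` on the COMPLEX disc, the Cauchy estimate gives
`‖G_L'(b)‖ ≤ K₂ b⁴`, and `HasDerivAt.real_of_complex` transfers `C_L' = G_L' + 4Jz³` to the real correlator.
HONEST: strong coupling only, group-blind; nothing here bears on `BalabanLadder.IR` at weak coupling, on the line's
XL loads, or on the Clay Yang–Mills mass gap (R4 closes only the conditional finite-𝕋⁴ rung `BalabanLadder.UV`).
-/


set_option autoImplicit false

noncomputable section

open MeasureTheory Filter Topology Function Finset Asymptotics Metric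
open Literature.MathematicalPhysics.QuantumFieldTheory
open Literature.MathematicalPhysics.QuantumLattice (haarConv plaquetteObs torusLift toTorusObservable LGConfig
  plaquetteHolonomyZd IsSimpleCompactGroup)

namespace Summit.QuantumFields.YangMills.Cruxes.IR.SCFloor

/-! ## §1 A Cauchy estimate: order `n` on a disc controls the derivative to order `n − 1` on the real axis -/

/-- **Cauchy estimate below an order-`n` Schwarz bound.**  If `f` is holomorphic on `‖z‖ < R'` and
`‖f z‖ ≤ M (‖z‖/r)^n` on the closed disc `‖z‖ ≤ r` (`r < R'`, `M ≥ 0`), then at every real `0 < b ≤ r/2`,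
`‖f'(b)‖ ≤ (2 M (3/2)^n / r^n) · b^(n-1)` (Cauchy's inequality on the circle of radius `b/2` about `b`). -/
theorem norm_deriv_le_of_norm_le_pow {f : ℂ → ℂ} {R' M r : ℝ} (hd : DifferentiableOn ℂ f (ball 0 R'))
    (hr : 0 < r) (hrR : r < R') (hM : 0 ≤ M) {n : ℕ} (hn : 1 ≤ n)
    (hf : ∀ z : ℂ, ‖z‖ ≤ r → ‖f z‖ ≤ M * (‖z‖ / r) ^ n) {b : ℝ} (hb : 0 < b) (hbr : b ≤ r / 2) :
    ‖deriv f b‖ ≤ 2 * M * (3 / 2) ^ n / r ^ n * b ^ (n - 1) := by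
  have hb2 : 0 < b / 2 := by positivity
  -- the closed disc of radius `b/2` about `b` lies in `‖z‖ ≤ 3b/2 ≤ r < R'`
  have hsub : ∀ z : ℂ, dist z (b : ℂ) ≤ b / 2 → ‖z‖ ≤ 3 / 2 * b := fun z hz => by
    have h1 : ‖z‖ ≤ ‖z - b‖ + ‖(b : ℂ)‖ := by
      calc ‖z‖ = ‖(z - b) + b‖ := by rw [sub_add_cancel]
        _ ≤ ‖z - b‖ + ‖(b : ℂ)‖ := norm_add_le _ _
    rw [Complex.norm_real, Real.norm_eq_abs, abs_of_pos hb, ← dist_eq_norm] at h1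
    linarith
  have hdc : DiffContOnCl ℂ f (ball (b : ℂ) (b / 2)) := by
    refine DifferentiableOn.diffContOnCl (hd.mono fun z hz => ?_)
    have hz' : dist z (b : ℂ) ≤ b / 2 := by
      have := closure_ball_subset_closedBall hz
      rwa [mem_closedBall] at this
    rw [mem_ball_zero_iff]
    have := hsub z hz'
    linarith
  have hC : ∀ z ∈ sphere (b : ℂ) (b / 2), ‖f z‖ ≤ M * ((3 / 2 * b) / r) ^ n := by
    intro z hz
    rw [mem_sphere] at hz
    have hz1 : ‖z‖ ≤ 3 / 2 * b := hsub z hz.le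
    have hz2 : ‖z‖ ≤ r := by linarith
    refine (hf z hz2).trans (mul_le_mul_of_nonneg_left ?_ hM)
    exact pow_le_pow_left₀ (by positivity) (div_le_div_of_nonneg_right hz1 hr.le) n
  have h := Complex.norm_deriv_le_of_forall_mem_sphere_norm_le hb2 hdc hC
  -- arithmetic: `M ((3b/2)/r)^n / (b/2) = 2 M (3/2)^n / r^n · b^(n-1)`
  have hbn : b ^ n = b ^ (n - 1) * b := by
    rw [← pow_succ, Nat.sub_add_cancel hn]
  calc ‖deriv f b‖ ≤ M * ((3 / 2 * b) / r) ^ n / (b / 2) := h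
    _ = 2 * M * (3 / 2) ^ n / r ^ n * b ^ (n - 1) := by
        rw [div_pow, mul_pow, hbn]
        field_simp

/-! ## §2 The facing-plaquette covariance and its β-derivative to leading order, uniformly in the volume -/

variable {G : Type} [Group G] [TopologicalSpace G] [IsTopologicalGroup G] [CompactSpace G] [MeasurableSpace G]
  [BorelSpace G] [SecondCountableTopology G] [T2Space G] {N : ℕ} (ρ : G →* Matrix (Fin N) (Fin N) ℂ)

/-- **The facing-plaquette correlator and its β-slope to leading order, UNIFORMLY IN THE VOLUME.**  There are
`K₁, K₂ ≥ 0` and `b₀ > 0` (depending only on `ρ`) such that on every torus `(ℤ/L)⁴`, `L ≥ 3`, and for all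
`0 < b ≤ b₀`, with `D_L(b) = latticeConnectedCorr ρ b L P P 1` (`P = plaquetteObs ρ 0 1 2`) and `J = φ^{*6}(1)`,
`φ = Re tr ρ − ∫ Re tr ρ`:  `|D_L(b) − J b⁴| ≤ K₁ b⁵`, and `b ↦ D_L(b)` has a derivative `D'` at `b` with
`|D' − 4 J b³| ≤ K₂ b⁴`.  (Holomorphy on the strong-coupling disc with a volume-uniform bound, order `≥ 5` of
`D_L − J b⁴`, Schwarz lemma with multiplicity, Cauchy estimate.) -/
theorem cov_facing_deriv_estimate (hρ : Continuous ρ) :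
    ∃ K₁ K₂ b₀ : ℝ, 0 < b₀ ∧ 0 ≤ K₁ ∧ 0 ≤ K₂ ∧ ∀ (L : ℕ) [NeZero L], 3 ≤ L → ∀ b : ℝ, 0 < b → b ≤ b₀ →
      |latticeConnectedCorr ρ b L (plaquetteObs ρ 0 1 2) (plaquetteObs ρ 0 1 2) 1 -
          ((haarConv (fun g => (ρ g).trace.re - ∫ h, (ρ h).trace.re ∂haarProbability G))^[5]
            (fun g => (ρ g).trace.re - ∫ h, (ρ h).trace.re ∂haarProbability G)) 1 * b ^ 4| ≤ K₁ * b ^ 5 ∧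
        ∃ D' : ℝ, HasDerivAt (fun t : ℝ =>
            latticeConnectedCorr ρ t L (plaquetteObs ρ 0 1 2) (plaquetteObs ρ 0 1 2) 1) D' b ∧
          |D' - 4 * ((haarConv (fun g => (ρ g).trace.re - ∫ h, (ρ h).trace.re ∂haarProbability G))^[5]
            (fun g => (ρ g).trace.re - ∫ h, (ρ h).trace.re ∂haarProbability G)) 1 * b ^ 3| ≤ K₂ * b ^ 4 := by
  classical
  set J : ℝ := ((haarConv (fun g => (ρ g).trace.re - ∫ h, (ρ h).trace.re ∂haarProbability G))^[5]
    (fun g => (ρ g).trace.re - ∫ h, (ρ h).trace.re ∂haarProbability G)) 1 with hJ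
  -- uniform bounds on the observables
  obtain ⟨Ctr, hCtr0, hCtr⟩ := exists_bound_trace_re_nonneg (ρ := ρ) hρ
  -- the disc radius and the constants (uniform in `L`)
  set R : ℝ := betaOne 4 ρ with hRdef
  have hR0 : 0 < R := betaOne_pos 4 (ρ := ρ)
  set r : ℝ := R / 2 with hrdef
  have hr : 0 < r := by positivity
  have hrR : r < R := by rw [hrdef]; linarith
  set κ : ℝ := 2 * Real.exp (1 / 2) with hκ
  have hκ1 : 1 ≤ κ := by
    rw [hκ]; have := Real.one_lt_exp_iff.2 (by norm_num : (0 : ℝ) < 1 / 2); linarith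
  set sB : ℕ := 8 * (2 ^ 4 * (4 * 4)) with hsB
  set Kg : ℝ := Ctr * Ctr * κ ^ sB + Ctr * κ ^ sB * (Ctr * κ ^ sB) + |J| * R ^ 4 with hKg
  have hKg0 : 0 ≤ Kg := by positivity
  -- the output constants
  set K₁ : ℝ := Kg / r ^ 5 with hK₁
  set K₂ : ℝ := 2 * Kg * (3 / 2) ^ 5 / r ^ 5 with hK₂
  refine ⟨K₁, K₂, r / 2, by positivity, by positivity, by positivity, fun L _ hL b hb0 hb => ?_⟩
  haveI : Fact (1 < L) := ⟨by omega⟩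
  have hbr : b ≤ r := hb.trans (by linarith)
  have hbR : b < R := lt_of_le_of_lt hbr hrR
  -- part 9 on this torus (real axis)
  obtain ⟨K, b₁, hb₁, htorus⟩ := torus_cov_facing_estimate (L := L) ρ hρ hL
  -- the observables of `ℤ⁴` and their periodic versions
  set x₀ : Literature.Probability.LatticeModels.Site 4 := 0 with hx₀
  set x₁ : Literature.Probability.LatticeModels.Site 4 := Pi.single 0 1 with hx₁
  set F₁ : LGConfig 4 G → ℝ := plaquetteObs ρ x₀ 1 2 with hF₁
  set F₂ : LGConfig 4 G → ℝ := plaquetteObs ρ x₁ 1 2 with hF₂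
  have hF₁m : Measurable F₁ := measurable_trace_re_plaquette ρ hρ x₀ 1 2
  have hF₂m : Measurable F₂ := measurable_trace_re_plaquette ρ hρ x₁ 1 2
  have hF₁b : ∀ U, |F₁ U| ≤ Ctr := fun U => by simp only [hF₁]; exact hCtr _
  have hF₂b : ∀ U, |F₂ U| ≤ Ctr := fun U => by simp only [hF₂]; exact hCtr _
  have hF12m : Measurable fun U => F₁ U * F₂ U := hF₁m.mul hF₂m
  have hF12b : ∀ U, |F₁ U * F₂ U| ≤ Ctr * Ctr := fun U => by
    rw [abs_mul]; exact mul_le_mul (hF₁b U) (hF₂b U) (abs_nonneg _) hCtr0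
  -- torus observables are the plaquette traces
  have hp0 : (Literature.Probability.LatticeModels.Torus.proj L x₀ : Site 4 L) = 0 := by
    funext k; simp [hx₀, Literature.Probability.LatticeModels.Torus.proj_apply]
  have hp1 : (Literature.Probability.LatticeModels.Torus.proj L x₁ : Site 4 L) = (0 : Site 4 L).shift 0 := by
    rw [hx₁, torusProj_site_single]; simp [Site.shift]
  have hT₁ : toTorusObservable L F₁ = fun U : GaugeConfig 4 L G => (ρ (plaquetteHolonomy U 0 1 2)).trace.re := by
    rw [hF₁, toTorusObservable_plaquetteObs_eq, hp0]
  have hT₂ : toTorusObservable L F₂ = fun U : GaugeConfig 4 L G =>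
      (ρ (plaquetteHolonomy U ((0 : Site 4 L).shift 0) 1 2)).trace.re := by
    rw [hF₂, toTorusObservable_plaquetteObs_eq, hp1]
  have hT₁₂ : toTorusObservable L (fun U => F₁ U * F₂ U) = fun U : GaugeConfig 4 L G =>
      (ρ (plaquetteHolonomy U 0 1 2)).trace.re * (ρ (plaquetteHolonomy U ((0 : Site 4 L).shift 0) 1 2)).trace.re := by
    funext U
    have h1 := congrFun hT₁ U
    have h2 := congrFun hT₂ U
    simp only [toTorusObservable, Function.comp_apply] at h1 h2 ⊢
    rw [h1, h2]
  -- the complex expectations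
  set S := torusSystem (d := 4) (G := G) ρ L with hSdef
  have hReg : S.Regular (costBound ρ) (Plaq.degBound 4) := torusSystem_regular ρ hρ
  set V := torusGenuine 4 L with hV
  set Φ₁ : ZdGaugeConfig 4 G → ℂ := fun U => (F₁ (U ∘ torusRed L) : ℂ) with hΦ₁
  set Φ₂ : ZdGaugeConfig 4 G → ℂ := fun U => (F₂ (U ∘ torusRed L) : ℂ) with hΦ₂
  have hΦ₁m : Measurable Φ₁ := Complex.measurable_ofReal.comp (hF₁m.comp (measurable_comp_relabel (torusRed L)))
  have hΦ₂m : Measurable Φ₂ := Complex.measurable_ofReal.comp (hF₂m.comp (measurable_comp_relabel (torusRed L)))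
  have hΦ₁b : ∀ U, ‖Φ₁ U‖ ≤ Ctr := fun U => by rw [hΦ₁, Complex.norm_real, Real.norm_eq_abs]; exact hF₁b _
  have hΦ₂b : ∀ U, ‖Φ₂ U‖ ≤ Ctr := fun U => by rw [hΦ₂, Complex.norm_real, Real.norm_eq_abs]; exact hF₂b _
  have h12d : ((1 : Fin 4), (2 : Fin 4)).1 < ((1 : Fin 4), (2 : Fin 4)).2 := by decide
  set P0z : Literature.MathematicalPhysics.QuantumLattice.ZdPlaquette 4 := (x₀, ⟨((1 : Fin 4), (2 : Fin 4)), h12d⟩) with hP0z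
  set P1z : Literature.MathematicalPhysics.QuantumLattice.ZdPlaquette 4 := (x₁, ⟨((1 : Fin 4), (2 : Fin 4)), h12d⟩) with hP1z
  set B₁ : Finset (ZdEdge 4) := Literature.MathematicalPhysics.QuantumLattice.plaquetteEdges P0z with hB₁
  set B₂ : Finset (ZdEdge 4) := Literature.MathematicalPhysics.QuantumLattice.plaquetteEdges P1z with hB₂
  have hF₁d : DependsOn F₁ (B₁ : Set (ZdEdge 4)) :=
    Literature.MathematicalPhysics.QuantumLattice.isCylinder_plaquetteObs (G := G) ρ P0z
  have hF₂d : DependsOn F₂ (B₂ : Set (ZdEdge 4)) :=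
    Literature.MathematicalPhysics.QuantumLattice.isCylinder_plaquetteObs (G := G) ρ P1z
  have hΦ₁d : DependsOn Φ₁ ((B₁.image (torusRed L) : Finset (ZdEdge 4)) : Set (ZdEdge 4)) :=
    dependsOn_comp_torusRed L (F := fun U => (F₁ U : ℂ)) fun U W h => by
      show (F₁ U : ℂ) = F₁ W; rw [hF₁d h]
  have hΦ₂d : DependsOn Φ₂ ((B₂.image (torusRed L) : Finset (ZdEdge 4)) : Set (ZdEdge 4)) :=
    dependsOn_comp_torusRed L (F := fun U => (F₂ U : ℂ)) fun U W h => by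
      show (F₂ U : ℂ) = F₂ W; rw [hF₂d h]
  -- seed counts, uniformly in `L`
  have hB₁c : B₁.card ≤ 4 := Finset.card_le_four
  have hB₂c : B₂.card ≤ 4 := Finset.card_le_four
  have hs₁ : (S.seedsOf (B₁.image (torusRed L))).card ≤ sB := by
    refine (card_seedsOf_torusSystem_le ρ B₁).trans ((card_seedsOf_le_mul B₁).trans ?_)
    rw [hsB]; exact Nat.mul_le_mul_right _ (by omega)
  have hs₂ : (S.seedsOf (B₂.image (torusRed L))).card ≤ sB := by
    refine (card_seedsOf_torusSystem_le ρ B₂).trans ((card_seedsOf_le_mul B₂).trans ?_)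
    rw [hsB]; exact Nat.mul_le_mul_right _ (by omega)
  have hs₁₂ : (S.seedsOf (B₁.image (torusRed L) ∪ B₂.image (torusRed L))).card ≤ sB := by
    rw [← Finset.image_union]
    refine (card_seedsOf_torusSystem_le ρ _).trans ((card_seedsOf_le_mul _).trans ?_)
    rw [hsB]
    exact Nat.mul_le_mul_right _ ((Finset.card_union_le _ _).trans (by omega))
  -- the holomorphic covariance `Cf` and its remainder `Gf = Cf − J β⁴`
  set Cf : ℂ → ℂ := fun β => S.expect (fun U => Φ₁ U * Φ₂ U) V β - S.expect Φ₁ V β * S.expect Φ₂ V β with hCf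
  set Gf : ℂ → ℂ := fun β => Cf β - (J : ℂ) * β ^ 4 with hGf
  have h12 : ∀ U, ‖Φ₁ U * Φ₂ U‖ ≤ Ctr * Ctr := fun U => by
    rw [norm_mul]; exact mul_le_mul (hΦ₁b U) (hΦ₂b U) (norm_nonneg _) hCtr0
  have hRβ : PlaqSystem.betaR (costBound ρ) (Plaq.degBound 4) = R := by rw [hRdef, betaR_costBound]
  have hCdiff : DifferentiableOn ℂ Cf (ball 0 R) := by
    rw [← hRβ]
    exact (PlaqSystem.differentiableOn_expect hReg (hΦ₁m.mul hΦ₂m) h12 V).sub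
      ((PlaqSystem.differentiableOn_expect hReg hΦ₁m hΦ₁b V).mul
        (PlaqSystem.differentiableOn_expect hReg hΦ₂m hΦ₂b V))
  have hJdiff : Differentiable ℂ fun β : ℂ => (J : ℂ) * β ^ 4 :=
    (differentiable_const _).mul (differentiable_id.pow 4)
  have hGdiff : DifferentiableOn ℂ Gf (ball 0 R) := hCdiff.sub hJdiff.differentiableOn
  have hGbound : ∀ z ∈ ball (0 : ℂ) R, ‖Gf z‖ ≤ Kg := by
    intro z hz
    have hz' : ‖z‖ ≤ PlaqSystem.betaR (costBound ρ) (Plaq.degBound 4) := by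
      rw [hRβ]; exact le_of_lt (mem_ball_zero_iff.1 hz)
    have htr := PlaqSystem.norm_truncatedExpect_le_const hReg hz' hΦ₁m hΦ₂m hΦ₁b hΦ₂b hΦ₁d hΦ₂d V
    have hzR : ‖z‖ ≤ R := by rwa [hRβ] at hz'
    calc ‖Gf z‖ ≤ ‖S.expect (fun U => Φ₁ U * Φ₂ U) V z - S.expect Φ₁ V z * S.expect Φ₂ V z‖ + ‖(J : ℂ) * z ^ 4‖ :=
          norm_sub_le _ _
      _ ≤ (Ctr * Ctr * κ ^ sB + Ctr * κ ^ sB * (Ctr * κ ^ sB)) + |J| * R ^ 4 := by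
          refine add_le_add (htr.trans ?_) ?_
          · refine add_le_add (mul_le_mul_of_nonneg_left (pow_le_pow_right₀ hκ1 hs₁₂) (by positivity))
              (mul_le_mul (mul_le_mul_of_nonneg_left (pow_le_pow_right₀ hκ1 hs₁) hCtr0)
                (mul_le_mul_of_nonneg_left (pow_le_pow_right₀ hκ1 hs₂) hCtr0) (by positivity) (by positivity))
          · rw [norm_mul, Complex.norm_real, Real.norm_eq_abs, norm_pow]
            exact mul_le_mul_of_nonneg_left (pow_le_pow_left₀ (norm_nonneg _) hzR 4) (abs_nonneg _)
      _ = Kg := by rw [hKg]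
  -- the real covariance of the statement, as a function of real `t`
  set cov : ℝ → ℝ := fun t =>
    (∫ U, (ρ (plaquetteHolonomy U 0 1 2)).trace.re * (ρ (plaquetteHolonomy U ((0 : Site 4 L).shift 0) 1 2)).trace.re
        ∂(wilsonMeasure (d := 4) (L := L) ρ t)) -
      (∫ U, (ρ (plaquetteHolonomy U 0 1 2)).trace.re ∂(wilsonMeasure (d := 4) (L := L) ρ t)) *
        ∫ U, (ρ (plaquetteHolonomy U ((0 : Site 4 L).shift 0) 1 2)).trace.re ∂(wilsonMeasure (d := 4) (L := L) ρ t)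
    with hcov
  have hcorr : ∀ t : ℝ, latticeConnectedCorr ρ t L (plaquetteObs ρ 0 1 2) (plaquetteObs ρ 0 1 2) 1 = cov t :=
    fun t => latticeConnectedCorr_plaquette_one ρ L t
  -- on the real axis `Cf t` is the real covariance
  have hCreal : ∀ t : ℝ, Cf t = ((cov t : ℝ) : ℂ) := by
    intro t
    have e12 := wilsonExpectation_toTorusObservable_eq_re_expect (L := L) ρ hρ t hF12m hF12b
    have e1 := wilsonExpectation_toTorusObservable_eq_re_expect (L := L) ρ hρ t hF₁m hF₁b
    have e2 := wilsonExpectation_toTorusObservable_eq_re_expect (L := L) ρ hρ t hF₂m hF₂b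
    rw [hT₁₂] at e12; rw [hT₁] at e1; rw [hT₂] at e2
    simp only [wilsonExpectation] at e12 e1 e2
    have i12 := PlaqSystem.expect_ofReal_im (S := S) (fun U => F₁ (U ∘ torusRed L) * F₂ (U ∘ torusRed L)) V t
    have i1 := PlaqSystem.expect_ofReal_im (S := S) (fun U => F₁ (U ∘ torusRed L)) V t
    have i2 := PlaqSystem.expect_ofReal_im (S := S) (fun U => F₂ (U ∘ torusRed L)) V t
    have c1 : S.expect Φ₁ V t =
        ((∫ U, (ρ (plaquetteHolonomy U 0 1 2)).trace.re ∂(wilsonMeasure (d := 4) (L := L) ρ t) : ℝ) : ℂ) :=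
      Complex.ext (by rw [Complex.ofReal_re]; exact e1.symm) (by rw [Complex.ofReal_im]; exact i1)
    have c2 : S.expect Φ₂ V t =
        ((∫ U, (ρ (plaquetteHolonomy U ((0 : Site 4 L).shift 0) 1 2)).trace.re
          ∂(wilsonMeasure (d := 4) (L := L) ρ t) : ℝ) : ℂ) :=
      Complex.ext (by rw [Complex.ofReal_re]; exact e2.symm) (by rw [Complex.ofReal_im]; exact i2)
    have hprod : (fun U : ZdGaugeConfig 4 G => Φ₁ U * Φ₂ U) =
        fun U => (((F₁ (U ∘ torusRed L) * F₂ (U ∘ torusRed L)) : ℝ) : ℂ) := by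
      funext U; simp only [hΦ₁, hΦ₂]; push_cast; ring
    have c12 : S.expect (fun U => Φ₁ U * Φ₂ U) V t =
        ((∫ U, (ρ (plaquetteHolonomy U 0 1 2)).trace.re * (ρ (plaquetteHolonomy U ((0 : Site 4 L).shift 0) 1 2)).trace.re
          ∂(wilsonMeasure (d := 4) (L := L) ρ t) : ℝ) : ℂ) := by
      rw [hprod]
      exact Complex.ext (by rw [Complex.ofReal_re]; exact e12.symm) (by rw [Complex.ofReal_im]; exact i12)
    simp only [hCf, hcov]
    rw [c12, c1, c2]
    push_cast
    ring
  have hGreal : ∀ t : ℝ, Gf t = ((cov t - J * t ^ 4 : ℝ) : ℂ) := by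
    intro t
    simp only [hGf, hCreal t, Complex.ofReal_sub, Complex.ofReal_mul, Complex.ofReal_pow]
  -- order `≥ 5` at `0` (part 9, this torus) and the volume-uniform Schwarz bound on the complex disc `‖z‖ ≤ r`
  have hreal5 : ∀ t : ℝ, 0 < t → t ≤ b₁ → ‖Gf t‖ ≤ K * t ^ 5 := by
    intro t ht0 ht1
    rw [hGreal t, Complex.norm_real, Real.norm_eq_abs]
    have := htorus t (by rw [abs_of_pos ht0]; exact ht1)
    rw [abs_of_pos ht0] at this
    simpa only [hcov] using this
  have hana : AnalyticAt ℂ Gf 0 :=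
    (hGdiff.analyticOnNhd isOpen_ball) 0 (mem_ball_self hR0)
  have hO := isBigO_pow_of_real_bound hana hb₁ hreal5
  have hSchwarz : ∀ z : ℂ, ‖z‖ ≤ r → ‖Gf z‖ ≤ Kg * (‖z‖ / r) ^ 5 := fun z hz =>
    norm_le_of_isBigO_pow hGdiff hGbound hO hr hrR hz
  -- (i) the covariance to order `b⁴`
  have hE : |cov b - J * b ^ 4| ≤ K₁ * b ^ 5 := by
    have h := hSchwarz (b : ℂ) (by rw [Complex.norm_real, Real.norm_eq_abs, abs_of_pos hb0]; exact hbr)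
    rw [hGreal b, Complex.norm_real, Real.norm_eq_abs, Complex.norm_real, Real.norm_eq_abs, abs_of_pos hb0] at h
    calc |cov b - J * b ^ 4| ≤ Kg * (b / r) ^ 5 := h
      _ = K₁ * b ^ 5 := by rw [hK₁, div_pow, ← mul_div_assoc, div_mul_eq_mul_div]
  -- (ii) the derivative: Cauchy estimate for `Gf'`, plus `4 J b³` from the explicit quartic
  have hGd : ‖deriv Gf b‖ ≤ K₂ * b ^ 4 := by
    have h := norm_deriv_le_of_norm_le_pow hGdiff hr hrR hKg0 (n := 5) (by norm_num) hSchwarz hb0 hb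
    simpa only [hK₂] using h
  have hbmem : (b : ℂ) ∈ ball (0 : ℂ) R := by
    rw [mem_ball_zero_iff, Complex.norm_real, Real.norm_eq_abs, abs_of_pos hb0]; exact hbR
  have hGat : HasDerivAt Gf (deriv Gf b) b :=
    ((hGdiff.differentiableAt (isOpen_ball.mem_nhds hbmem)).hasDerivAt)
  have hJat : HasDerivAt (fun β : ℂ => (J : ℂ) * β ^ 4) ((J : ℂ) * ((4 : ℕ) * (b : ℂ) ^ 3)) b := by
    have := (hasDerivAt_pow 4 (b : ℂ)).const_mul (J : ℂ)
    simpa using this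
  have hCat : HasDerivAt Cf (deriv Gf b + (J : ℂ) * ((4 : ℕ) * (b : ℂ) ^ 3)) b := by
    have h := hGat.add hJat
    have hfun : (Gf + fun β : ℂ => (J : ℂ) * β ^ 4) = Cf := by
      funext β; simp only [Pi.add_apply, hGf]; ring
    rwa [hfun] at h
  -- transfer to the real function
  have hRe : HasDerivAt (fun t : ℝ => (Cf t).re) (deriv Gf b + (J : ℂ) * ((4 : ℕ) * (b : ℂ) ^ 3)).re b :=
    hCat.real_of_complex
  have hfunR : (fun t : ℝ => (Cf t).re) =
      fun t : ℝ => latticeConnectedCorr ρ t L (plaquetteObs ρ 0 1 2) (plaquetteObs ρ 0 1 2) 1 := by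
    funext t; rw [hCreal t, Complex.ofReal_re, hcorr t]
  rw [hfunR] at hRe
  have hre_eq : (deriv Gf b + (J : ℂ) * ((4 : ℕ) * (b : ℂ) ^ 3)).re = (deriv Gf b).re + 4 * J * b ^ 3 := by
    have : ((J : ℂ) * ((4 : ℕ) * (b : ℂ) ^ 3)) = ((4 * J * b ^ 3 : ℝ) : ℂ) := by push_cast; ring
    rw [Complex.add_re, this, Complex.ofReal_re]
  rw [hre_eq] at hRe
  refine ⟨by rw [hcorr b]; exact hE, (deriv Gf b).re + 4 * J * b ^ 3, hRe, ?_⟩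
  rw [show (deriv Gf b).re + 4 * J * b ^ 3 - 4 * J * b ^ 3 = (deriv Gf b).re by ring]
  exact (Complex.abs_re_le_norm _).trans hGd

end Summit.QuantumFields.YangMills.Cruxes.IR.SCFloor

end
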